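import Summits.RiemannHypothesis.RiemannHypothesis.Theses.RuelleBand
import Summits.RiemannHypothesis.RiemannHypothesis.Theorems.RuelleBandCofiniteCriticalLineStubIndexCalibration
import Literature.Analysis.OperatorTheory.KreinLangerDefinitizationProofs
import HarnessLib

/-!
# `CofiniteCriticalLine ⟺ BoundedWeilIndex` — UNCONDITIONAL

Crux `Summit.RiemannHypothesis.RiemannHypothesis.Theses.RuelleBand.CofiniteCriticalLine` (item
stmt-RiemannHypothesis-2064: all but finitely many non-trivial zeros of `ζ` lie on the critical line),
line `cofinite-weil-index-staircase` (continuation lead prover-line-stmt-RiemannHypothesis-2064-c1-0, 2026-08-16).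

The conditional equivalences `boundedWeilIndex_iff_cofiniteCriticalLine_of_krein`,
`boundedWeilIndex'_iff_cofiniteCriticalLine_of_krein` (p104589) were stated modulo the named Literature fact
`Literature.Analysis.OperatorTheory.KreinDefinitization` (Kreĭn 1959 / Stewart 1972 definitization of smooth
Hermitian functions with finitely many negative squares), now PROVED in the tree
(`Literature.Analysis.OperatorTheory.KreinDefinitization_holds`).  With the hypothesis discharged (the one-sided
unconditional rung is `cofiniteCriticalLine_of_boundedWeilIndex`,
`Theorems/RuelleBandCofiniteCriticalLineBoundedIndexUnconditional.lean`, p107208) the crux is EQUIVALENT, with no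
hypothesis left, to the bounded Weil index:

* `boundedWeilIndex_iff_cofiniteCriticalLine` (window form): there is `N` such that on every window `[-a, a]` every
  `(N+1)`-tuple of Weil test functions supported in the window has a non-zero `ℂ`-combination with `0 ≤ Re Q`;
* `boundedWeilIndex'_iff_cofiniteCriticalLine` (window-free form): the negative index of `Re Q` (`Q = weilQuadratic`)
  on all compactly supported test functions is finite.

So rung #5 of route `RuelleBand` is, kernel-checked in both directions, "Weil's quadratic form has finite total
negative index on `C_c^∞`" (Bombieri 2000 §§10–11 count these negative squares under the crux).  What remains of the
line is its bet END (`stub_eventuallyNondegenerate`: no late conjugate window), which implies the bounded index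
through the landed stubs and is implied by RH (`stub_calibration_END_of_RH`).
-/

set_option linter.dupNamespace false

noncomputable section

open Complex MeasureTheory Filter Set
open scoped BigOperators Topology ComplexConjugate

namespace Summit.RiemannHypothesis.RiemannHypothesis.Theorems.RuelleBandCofiniteCriticalLine

open Literature.NumberTheory.LFunctions

/-- **`BoundedWeilIndex ⟺ CofiniteCriticalLine` (window form, unconditional).**  The crux of route
`RuelleBand` (all but finitely many non-trivial zeros of `ζ` on the critical line) is equivalent to a uniform
bound, over all windows `[-a, a]`, on the negative index of Weil's quadratic form `Re Q` on test functions
supported in the window.  Forward: `cofiniteCriticalLine_of_boundedWeilIndex` (Kreĭn definitization of the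
translation kernels + the converse Weil criterion inside one translation orbit); backward:
`stub_indexCalibration` (kernel of the evaluation map at the finitely many off-line zeros + the explicit
formula). [folklore] -/
theorem boundedWeilIndex_iff_cofiniteCriticalLine :
    ((∃ N : ℕ, ∀ a : ℝ, ∀ g : Fin (N + 1) → ℝ → ℂ, (∀ i, IsWeilTest (g i)) →
        (∀ i, tsupport (g i) ⊆ Set.Icc (-a) a) →
        ∃ c : Fin (N + 1) → ℂ, c ≠ 0 ∧ 0 ≤ (weilQuadratic (fun t => ∑ i, c i * g i t)).re) ↔
      Summit.RiemannHypothesis.RiemannHypothesis.Theses.RuelleBand.CofiniteCriticalLine) :=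
  boundedWeilIndex_iff_cofiniteCriticalLine_of_krein
    Literature.Analysis.OperatorTheory.KreinDefinitization_holds

/-- **`BoundedWeilIndex ⟺ CofiniteCriticalLine` (window-free form, unconditional)**: the crux is equivalent
to "there is `N` such that no `(N+1)`-tuple of Weil test functions spans a subspace on which `Re Q` is negative
definite" — finite total negative index of Weil's quadratic form on `C_c^∞`. [folklore] -/
theorem boundedWeilIndex'_iff_cofiniteCriticalLine :
    ((∃ N : ℕ, ∀ g : Fin (N + 1) → ℝ → ℂ, (∀ i, IsWeilTest (g i)) →
        ∃ c : Fin (N + 1) → ℂ, c ≠ 0 ∧ 0 ≤ (weilQuadratic (fun t => ∑ i, c i * g i t)).re) ↔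
      Summit.RiemannHypothesis.RiemannHypothesis.Theses.RuelleBand.CofiniteCriticalLine) :=
  boundedWeilIndex'_iff_cofiniteCriticalLine_of_krein
    Literature.Analysis.OperatorTheory.KreinDefinitization_holds

end Summit.RiemannHypothesis.RiemannHypothesis.Theorems.RuelleBandCofiniteCriticalLine

end
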